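import Literature.Computability.Complexity.SuccinctCircuitBitsReadout
import Literature.Computability.Complexity.StackWords
import HarnessLib

/-!
# Succinct arithmetic circuits of polynomial depth, V: INTEGER circuits, translated to natural
# circuits in two's complement

Sequel of parts I–IV. A consumer whose quantities are integers (the KV20 M1 linear algebra) writes
an `FP`-succinct INTEGER circuit — polynomial-time INTEGER constants (`cval`, code `intE`), sums of
exponential fan-in, binary products, select-on-congruence modulo `2^{W}` — together with an `FP`
two's-complement WIDTH `W` on names, constant along children. This file translates it once and for
all into a natural circuit (`SuccCircuit`, part I) computing two's-complement representatives, and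
proves the representatives represent:

* `SuccCircuitZ` — the structure; `SuccCircuitZ.valZ` — the integer value of a gate (`valZ_sum`,
  `valZ_mul`, `valZ_sel`, `valZ_const`).
* `SuccCircuitZ.toNat : SuccCircuit` — the same names, kinds, arities, children and depths; the
  constant `c` becomes the `W`-bit constant `c mod 2^W` (bits computed in polynomial time from the
  numeral of `c`: those of `c`, or the complements of those of `|c| − 1`, `testBit_twosRep_neg`);
  select gates compare the `W` low bits.
* **`SuccCircuitZ.val_toNat_modEq`** — for every gate, `val toNat g ≡ valZ g (mod 2^{W g})`
  (Knuth §4.1: sums and products of representatives are representatives; the select test is the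
  same congruence on both sides).
* Read-out under the bound `|valZ g| < 2^{W g − 1}` (which the consumer establishes from its own
  size estimates, e.g. with `val_lt_two_pow`): **`valZ_neg_iff`** (the sign is bit `W g − 1` of
  `val toNat g`), **`valZ_eq_zero_iff`** (zero test = the select gate's test against a zero
  constant), **`testBit_natAbs_valZ`** (for `valZ g ≥ 0` the bits of `|valZ g|` are `bitLang`
  queries on `g`); for `valZ g < 0` the consumer asks the same of a gate denoting `−valZ g` (e.g. a
  product with the constant `−1`). With part III (`bitLang_mem_PSPACE`) every such query is a
  `PSPACE` query: the consumer writes no machine — **`SuccCircuitZ.signMag_mem_PSPACE`** (from part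
  VII's `signMag_mem_PSPACE_of_rep`): with polynomial-time query decoders, `{w | (knd w = 1 ∧
  valZ (pos w) < 0) ∨ (knd w = 0 ∧ bit (idx w) of |valZ (pos w)| = 1)} ∈ PSPACE`.

HONEST FRAMING (val-lit, KV20 M1 programme, brick (P2) layer G): generic plumbing; proves nothing
about `kumarVolk2020_cor_1_3` by itself; `VP ≠ VNP` is NOT proved and nothing here bears on it.

## References

* P. Koiran, S. Perifel, *VPSPACE and a transfer theorem over the reals*, Comput. Complexity 18
  (2009), §3.1 Def. 1, §3.2 Prop. 1 [KoiranPerifel2009VPSPACE].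
* D. E. Knuth, *TAOCP 2*, §4.1 (two's complement notation) [KnuthTAOCP2].
* S. Arora, B. Barak, *Computational Complexity*, §1.3 [AroraBarak2009].
-/

noncomputable section

namespace Literature.Computability.Complexity

open _root_.Computability Polynomial CodeFP Brick Finset

/-- **A succinctly given variable-free arithmetic circuit over `ℤ` of polynomial depth, with a
two's-complement width.** As `SuccCircuit` (kinds `1` sum, `2` product, `3` select, else constant;
children no longer than the parent; depth strictly decreasing, polynomially bounded), but the
constant of a constant gate is a polynomial-time INTEGER `cval g`, and every name carries a width
`W g ≥ 1`, polynomial-time, equal for a gate and its children; a select gate yields child `2` if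
children `0`, `1` are congruent modulo `2^{W g}`, else child `3`. [cite: KoiranPerifel2009VPSPACE, §3.2, Prop. 1 (Uniform VPAR⁰)] [cite: KnuthTAOCP2, §4.1] -/
structure SuccCircuitZ where
  /-- kind of a gate: `1` sum, `2` product, `3` select, anything else constant -/
  kind : List Bool → ℕ
  /-- the integer constant of a constant gate -/
  cval : List Bool → ℤ
  /-- number of children of a sum gate -/
  arity : List Bool → ℕ
  /-- the `k`-th child of a gate -/
  child : List Bool → ℕ → List Bool
  /-- the two's-complement width carried by a name -/
  W : List Bool → ℕ
  /-- a depth function: strictly decreasing to children -/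
  depth : List Bool → ℕ
  /-- polynomial bound of the depth in the name length -/
  dpoly : Polynomial ℕ
  /-- `kind` is polynomial-time on names -/
  kind_fp : CodeFP strE natE kind
  /-- `cval` is polynomial-time on names -/
  cval_fp : CodeFP strE intE cval
  /-- `arity` is polynomial-time on names -/
  arity_fp : CodeFP strE natE arity
  /-- children are polynomial-time on `⟨name, child index⟩` -/
  child_fp : CodeFP (pairE strE natE) strE (fun p => child p.1 p.2)
  /-- `W` is polynomial-time on names -/
  W_fp : CodeFP strE natE W
  /-- widths are positive -/
  W_pos : ∀ g, 1 ≤ W g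
  /-- a gate and its children carry the same width -/
  W_child : ∀ g k, k < gateFanIn (kind g) (arity g) → W (child g k) = W g
  /-- the depth strictly decreases from a gate to each of its children -/
  depth_child : ∀ g k, k < gateFanIn (kind g) (arity g) → depth (child g k) < depth g
  /-- children's names are no longer than the parent's -/
  length_child : ∀ g k, k < gateFanIn (kind g) (arity g) → (child g k).length ≤ g.length
  /-- the depth is polynomially bounded in the name length -/
  depth_le : ∀ g, depth g ≤ dpoly.eval g.length

namespace SuccCircuitZ

variable (Z : SuccCircuitZ)

/-! ### Integer values -/

/-- The integer value with fuel. [cite: KoiranPerifel2009VPSPACE, §3.2, Prop. 1 (proof)] -/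
def valZN : ℕ → List Bool → ℤ
  | 0, g => if Z.kind g = 1 ∨ Z.kind g = 2 ∨ Z.kind g = 3 then 0 else Z.cval g
  | n + 1, g =>
    if Z.kind g = 1 then ∑ k ∈ range (Z.arity g), valZN n (Z.child g k)
    else if Z.kind g = 2 then valZN n (Z.child g 0) * valZN n (Z.child g 1)
    else if Z.kind g = 3 then
      (if valZN n (Z.child g 0) ≡ valZN n (Z.child g 1) [ZMOD 2 ^ Z.W g]
        then valZN n (Z.child g 2) else valZN n (Z.child g 3))
    else Z.cval g

/-- **The integer value of a gate.** [cite: KoiranPerifel2009VPSPACE, §3.2, Prop. 1] -/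
def valZ (g : List Bool) : ℤ := Z.valZN (Z.depth g) g

/-- Fuel above the depth is irrelevant. [cite: KoiranPerifel2009VPSPACE, §3.2, Prop. 1 (proof: induction on the depth)] -/
theorem valZN_eq_valZ : ∀ (n : ℕ) (g : List Bool), Z.depth g ≤ n → Z.valZN n g = Z.valZ g := by
  intro n
  induction n using Nat.strong_induction_on with
  | _ n ih =>
    intro g hg
    rcases Nat.eq_or_lt_of_le hg with h | h
    · rw [valZ, h]
    · obtain ⟨m, rfl⟩ : ∃ m, n = m + 1 := ⟨n - 1, by omega⟩
      have hgm : Z.depth g ≤ m := by omega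
      have hch : ∀ k, k < gateFanIn (Z.kind g) (Z.arity g) → Z.valZN m (Z.child g k) = Z.valZ (Z.child g k) :=
        fun k hk => ih m (by omega) _ ((le_of_lt (Z.depth_child g k hk)).trans hgm)
      rw [valZ]
      rcases Nat.eq_zero_or_pos (Z.depth g) with h0 | hpos
      · rw [h0]
        simp only [valZN]
        by_cases h1 : Z.kind g = 1
        · have ha : Z.arity g = 0 := by
            by_contra hne
            have := Z.depth_child g 0 (by simp [gateFanIn, h1]; omega)
            omega
          simp [h1, ha]
        · by_cases h2 : Z.kind g = 2
          · have := Z.depth_child g 0 (by simp [gateFanIn, h2])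
            omega
          · by_cases h3 : Z.kind g = 3
            · have := Z.depth_child g 0 (by simp [gateFanIn, h3])
              omega
            · simp [h1, h2, h3]
      · obtain ⟨e, he⟩ : ∃ e, Z.depth g = e + 1 := ⟨Z.depth g - 1, by omega⟩
        have hch' : ∀ k, k < gateFanIn (Z.kind g) (Z.arity g) → Z.valZN e (Z.child g k) = Z.valZ (Z.child g k) :=
          fun k hk => ih e (by omega) _ (by have := Z.depth_child g k hk; omega)
        rw [he]
        simp only [valZN]
        by_cases h1 : Z.kind g = 1
        · simp only [h1, if_true]
          refine sum_congr rfl fun k hk => ?_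
          rw [mem_range] at hk
          rw [hch k (by simp [gateFanIn, h1, hk]), hch' k (by simp [gateFanIn, h1, hk])]
        · by_cases h2 : Z.kind g = 2
          · rw [if_neg h1, if_pos h2, if_neg h1, if_pos h2,
              hch 0 (by simp [gateFanIn, h2]), hch 1 (by simp [gateFanIn, h2]),
              hch' 0 (by simp [gateFanIn, h2]), hch' 1 (by simp [gateFanIn, h2])]
          · by_cases h3 : Z.kind g = 3
            · rw [if_neg h1, if_neg h2, if_pos h3, if_neg h1, if_neg h2, if_pos h3,
                hch 0 (by simp [gateFanIn, h3]), hch 1 (by simp [gateFanIn, h3]),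
                hch 2 (by simp [gateFanIn, h3]), hch 3 (by simp [gateFanIn, h3]),
                hch' 0 (by simp [gateFanIn, h3]), hch' 1 (by simp [gateFanIn, h3]),
                hch' 2 (by simp [gateFanIn, h3]), hch' 3 (by simp [gateFanIn, h3])]
            · rw [if_neg h1, if_neg h2, if_neg h3, if_neg h1, if_neg h2, if_neg h3]

/-- **Sum gates.** [cite: KoiranPerifel2009VPSPACE, §3.2, Prop. 1 (proof: "+-gate")] -/
theorem valZ_sum {g : List Bool} (h : Z.kind g = 1) :
    Z.valZ g = ∑ k ∈ range (Z.arity g), Z.valZ (Z.child g k) := by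
  rw [valZ]
  rcases Nat.eq_zero_or_pos (Z.depth g) with h0 | hpos
  · have ha : Z.arity g = 0 := by
      by_contra hne
      have := Z.depth_child g 0 (by simp [gateFanIn, h]; omega)
      omega
    rw [h0]
    simp [valZN, h, ha]
  · obtain ⟨e, he⟩ : ∃ e, Z.depth g = e + 1 := ⟨Z.depth g - 1, by omega⟩
    rw [he]
    simp only [valZN, h, if_true]
    refine sum_congr rfl fun k hk => Z.valZN_eq_valZ e _ ?_
    have := Z.depth_child g k (by simp [gateFanIn, h, mem_range.1 hk])
    omega

/-- **Product gates.** [cite: KoiranPerifel2009VPSPACE, §3.2, Prop. 1 (proof: "gate a × b")] -/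
theorem valZ_mul {g : List Bool} (h : Z.kind g = 2) :
    Z.valZ g = Z.valZ (Z.child g 0) * Z.valZ (Z.child g 1) := by
  have h0 := Z.depth_child g 0 (by simp [gateFanIn, h])
  have h1 := Z.depth_child g 1 (by simp [gateFanIn, h])
  obtain ⟨e, he⟩ : ∃ e, Z.depth g = e + 1 := ⟨Z.depth g - 1, by omega⟩
  rw [valZ, he]
  simp only [valZN, h, if_true, show (2 : ℕ) ≠ 1 by norm_num, if_false]
  rw [Z.valZN_eq_valZ e _ (by omega), Z.valZN_eq_valZ e _ (by omega)]

/-- **Select gates** (congruence modulo `2^{W g}`). [cite: KnuthTAOCP2, §4.1] -/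
theorem valZ_sel {g : List Bool} (h : Z.kind g = 3) :
    Z.valZ g = if Z.valZ (Z.child g 0) ≡ Z.valZ (Z.child g 1) [ZMOD 2 ^ Z.W g]
      then Z.valZ (Z.child g 2) else Z.valZ (Z.child g 3) := by
  have h0 := Z.depth_child g 0 (by simp [gateFanIn, h])
  have h1 := Z.depth_child g 1 (by simp [gateFanIn, h])
  have h2 := Z.depth_child g 2 (by simp [gateFanIn, h])
  have h3 := Z.depth_child g 3 (by simp [gateFanIn, h])
  obtain ⟨e, he⟩ : ∃ e, Z.depth g = e + 1 := ⟨Z.depth g - 1, by omega⟩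
  rw [valZ, he]
  simp only [valZN, h, if_true, show (3 : ℕ) ≠ 1 by norm_num, show (3 : ℕ) ≠ 2 by norm_num, if_false]
  rw [Z.valZN_eq_valZ e _ (by omega), Z.valZN_eq_valZ e _ (by omega), Z.valZN_eq_valZ e _ (by omega),
    Z.valZN_eq_valZ e _ (by omega)]

/-- **Constant gates.** [cite: KoiranPerifel2009VPSPACE, §3.2, Prop. 1 (proof: "input gates")] -/
theorem valZ_const {g : List Bool} (h1 : Z.kind g ≠ 1) (h2 : Z.kind g ≠ 2) (h3 : Z.kind g ≠ 3) :
    Z.valZ g = Z.cval g := by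
  rw [valZ]
  cases Z.depth g with
  | zero => simp [valZN, h1, h2, h3]
  | succ e => simp [valZN, h1, h2, h3]

/-! ### The translation to a natural circuit in two's complement -/

/-- The bits of the two's-complement representative of the constant `c` on `W` bits: those of `c`
if `c ≥ 0`, the complements of those of `|c| − 1` if `c < 0` (bit `i < W`). [cite: KnuthTAOCP2, §4.1 (complement and add one)] -/
def repBit (c : ℤ) (i : ℕ) : Bool :=
  if 0 ≤ c then c.natAbs.testBit i else !((c.natAbs - 1).testBit i)

/-- `repBit` is computed in polynomial time from `(c, i)` (numerals). [cite: AroraBarak2009, §1.3] -/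
theorem repBit_fp : CodeFP (pairE intE natE) bitE (fun p => repBit p.1 p.2) := by
  have hc : CodeFP (pairE intE natE) intE (fun p => p.1) := fst _ _
  have hi : CodeFP (pairE intE natE) natE (fun p => p.2) := snd _ _
  have habs : CodeFP (pairE intE natE) natE (fun p => p.1.natAbs) := intNatAbs.comp hc
  have hsgn : CodeFP (pairE intE natE) bitE (fun p => decide ((0 : ℤ) ≤ p.1)) :=
    intLe.comp ((const _ (0 : ℤ)).pair hc)
  -- bits of a numeral: `(natE n).getD i false = n.testBit i`
  have hbit : ∀ {f : ℤ × ℕ → ℕ}, CodeFP (pairE intE natE) natE f →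
      CodeFP (pairE intE natE) bitE (fun p => (f p).testBit p.2) := fun {f} hf =>
    (strGetDNat.comp ((strOfNat.comp hf).pair hi)).congr fun p => by
      simp only [natE]
      rw [← testBit_bitsToNat_eq_getD, bitsToNat_encodeNat]
  have hpos := hbit habs
  have hneg : CodeFP (pairE intE natE) bitE (fun p => !((p.1.natAbs - 1).testBit p.2)) :=
    (hbit (natSub.comp (habs.pair (const _ (1 : ℕ))))).not
  exact (hsgn.ite hpos hneg).congr fun p => by
    simp only [repBit]
    by_cases h : (0 : ℤ) ≤ p.1 <;> simp [h]

/-- **The natural circuit of an integer circuit**: same names, kinds, arities, children, depths;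
width `W g`; the constant gate `g` holds the two's-complement representative of `cval g`.
[cite: KnuthTAOCP2, §4.1] [cite: KoiranPerifel2009VPSPACE, §3.2, Prop. 1] -/
def toNat : SuccCircuit where
  kind := Z.kind
  width := Z.W
  cbit := fun g i => repBit (Z.cval g) i
  arity := Z.arity
  child := Z.child
  depth := Z.depth
  dpoly := Z.dpoly
  kind_fp := Z.kind_fp
  width_fp := Z.W_fp
  cbit_fp := repBit_fp.comp ((Z.cval_fp.comp (fst _ _)).pair (snd _ _))
  arity_fp := Z.arity_fp
  child_fp := Z.child_fp
  depth_child := Z.depth_child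
  length_child := Z.length_child
  depth_le := Z.depth_le

/-- A small constant's two's-complement gate holds a representative: for `|c| < 2^{W−1}`,
`cval_{toNat} g ≡ c (mod 2^W)`. [cite: KnuthTAOCP2, §4.1] -/
theorem cval_toNat_modEq {g : List Bool} (hc : (Z.cval g).natAbs < 2 ^ (Z.W g - 1)) :
    ((Z.toNat.cval g : ℕ) : ℤ) ≡ Z.cval g [ZMOD 2 ^ Z.W g] := by
  obtain ⟨v, hv⟩ : ∃ v, Z.W g = v + 1 := ⟨Z.W g - 1, by have := Z.W_pos g; omega⟩
  rw [hv] at hc ⊢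
  simp only [Nat.add_sub_cancel] at hc
  set c := Z.cval g with hcdef
  -- the constant gate's value has exactly the bits `repBit`, i.e. it IS `twosRep v c`
  have hval : Z.toNat.cval g = SuccCircuit.twosRep v c := by
    apply Nat.eq_of_testBit_eq
    intro i
    rw [Z.toNat.testBit_cval]
    change (decide (i < Z.W g) && repBit c i) = _
    rw [hv]
    by_cases h0 : 0 ≤ c
    · rw [SuccCircuit.twosRep_of_nonneg h0 (by
        have : (c.natAbs : ℤ) = c := by rw [Int.natCast_natAbs, abs_of_nonneg h0]
        have : (c.natAbs : ℤ) < 2 ^ v := by exact_mod_cast hc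
        linarith)]
      simp only [repBit, h0, if_true]
      by_cases hi : i < v + 1
      · simp [hi]
      · have : c.natAbs.testBit i = false :=
          Nat.testBit_lt_two_pow (hc.trans_le (Nat.pow_le_pow_right (by norm_num) (by omega)))
        simp [hi, this]
    · have h0' : c < 0 := lt_of_not_ge h0
      have hpos : 0 < c.natAbs := Int.natAbs_pos.2 h0'.ne
      rw [SuccCircuit.twosRep_of_neg h0' (by
        have : (c.natAbs : ℤ) = -c := by rw [Int.natCast_natAbs, abs_of_neg h0']
        have : (c.natAbs : ℤ) < 2 ^ v := by exact_mod_cast hc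
        linarith)]
      simp only [repBit, h0, if_false]
      by_cases hi : i < v + 1
      · rw [SuccCircuit.testBit_twosRep_neg hpos (le_of_lt hc) hi]; simp [hi]
      · have hlt : 2 ^ (v + 1) - c.natAbs < 2 ^ (v + 1) := by
          have := Nat.one_le_two_pow (n := v + 1); omega
        have : (2 ^ (v + 1) - c.natAbs).testBit i = false :=
          Nat.testBit_lt_two_pow (hlt.trans_le (Nat.pow_le_pow_right (by norm_num) (by omega)))
        simp [hi, this]
  rw [hval]
  exact SuccCircuit.twosRep_modEq v c

/-- **The translation computes representatives**: if every constant is small for its width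
(`|cval g| < 2^{W g − 1}`), then for every gate `val_{toNat} g ≡ valZ g (mod 2^{W g})`.
[cite: KnuthTAOCP2, §4.1 (sums and products in two's complement)] [cite: KoiranPerifel2009VPSPACE, §3.2, Prop. 1] -/
theorem val_toNat_modEq (hc : ∀ g, (Z.cval g).natAbs < 2 ^ (Z.W g - 1)) :
    ∀ (n : ℕ) (g : List Bool), Z.depth g ≤ n → ((Z.toNat.val g : ℕ) : ℤ) ≡ Z.valZ g [ZMOD 2 ^ Z.W g] := by
  intro n
  induction n with
  | zero =>
    intro g hg
    by_cases h1 : Z.kind g = 1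
    · have ha : Z.arity g = 0 := by
        by_contra hne
        have := Z.depth_child g 0 (by simp [gateFanIn, h1]; omega)
        omega
      have h1' : Z.toNat.kind g = 1 := h1
      rw [Z.toNat.val_sum h1', Z.valZ_sum h1, show Z.toNat.arity g = 0 from ha, ha]
      simp [Int.ModEq.refl]
    · by_cases h2 : Z.kind g = 2
      · have := Z.depth_child g 0 (by simp [gateFanIn, h2]); omega
      · by_cases h3 : Z.kind g = 3
        · have := Z.depth_child g 0 (by simp [gateFanIn, h3]); omega
        · rw [Z.toNat.val_const h1 h2 h3, Z.valZ_const h1 h2 h3]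
          exact Z.cval_toNat_modEq (hc g)
  | succ n ih =>
    intro g hg
    have hch : ∀ k, k < gateFanIn (Z.kind g) (Z.arity g) →
        ((Z.toNat.val (Z.child g k) : ℕ) : ℤ) ≡ Z.valZ (Z.child g k) [ZMOD 2 ^ Z.W g] := by
      intro k hk
      have hdk : Z.depth (Z.child g k) ≤ n := by have := Z.depth_child g k hk; omega
      rw [← Z.W_child g k hk]
      exact ih _ hdk
    by_cases h1 : Z.kind g = 1
    · have h1' : Z.toNat.kind g = 1 := h1
      rw [Z.toNat.val_sum h1', Z.valZ_sum h1, show Z.toNat.arity g = Z.arity g from rfl]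
      obtain ⟨v, hv⟩ : ∃ v, Z.W g = v + 1 := ⟨Z.W g - 1, by have := Z.W_pos g; omega⟩
      rw [hv]
      refine SuccCircuit.sum_rep (Z.arity g) fun k hk => ?_
      rw [← hv]
      exact hch k (by simp [gateFanIn, h1, hk])
    · by_cases h2 : Z.kind g = 2
      · have h2' : Z.toNat.kind g = 2 := h2
        rw [Z.toNat.val_mul h2', Z.valZ_mul h2]
        have e0 := hch 0 (by simp [gateFanIn, h2])
        have e1 := hch 1 (by simp [gateFanIn, h2])
        push_cast
        exact e0.mul e1
      · by_cases h3 : Z.kind g = 3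
        · have h3' : Z.toNat.kind g = 3 := h3
          rw [Z.toNat.val_mux h3', Z.valZ_sel h3]
          have e0 := hch 0 (by simp [gateFanIn, h3])
          have e1 := hch 1 (by simp [gateFanIn, h3])
          have e2 := hch 2 (by simp [gateFanIn, h3])
          have e3 := hch 3 (by simp [gateFanIn, h3])
          -- the two tests agree: congruence of the representatives is congruence of the integers
          have hN : (Z.toNat.val (Z.child g 0) % 2 ^ Z.W g = Z.toNat.val (Z.child g 1) % 2 ^ Z.W g) ↔
              ((Z.toNat.val (Z.child g 0) : ℕ) : ℤ) ≡ Z.toNat.val (Z.child g 1) [ZMOD 2 ^ Z.W g] := by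
            rw [Int.ModEq]
            constructor
            · intro h; exact_mod_cast congrArg (Nat.cast : ℕ → ℤ) h
            · intro h; exact_mod_cast h
          have htest : (Z.toNat.val (Z.child g 0) % 2 ^ Z.toNat.width g = Z.toNat.val (Z.child g 1) % 2 ^ Z.toNat.width g) ↔
              (Z.valZ (Z.child g 0) ≡ Z.valZ (Z.child g 1) [ZMOD 2 ^ Z.W g]) := by
            change (Z.toNat.val (Z.child g 0) % 2 ^ Z.W g = Z.toNat.val (Z.child g 1) % 2 ^ Z.W g) ↔ _
            rw [hN]
            exact ⟨fun h => (e0.symm.trans h).trans e1, fun h => (e0.trans h).trans e1.symm⟩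
          simp only [show Z.toNat.child = Z.child from rfl] at htest ⊢
          by_cases hB : Z.valZ (Z.child g 0) ≡ Z.valZ (Z.child g 1) [ZMOD 2 ^ Z.W g]
          · rw [if_pos (htest.2 hB), if_pos hB]; exact e2
          · rw [if_neg (fun h => hB (htest.1 h)), if_neg hB]; exact e3
        · rw [Z.toNat.val_const h1 h2 h3, Z.valZ_const h1 h2 h3]
          exact Z.cval_toNat_modEq (hc g)

/-! ### Read-out: sign, zero test, magnitude bits as queries on the natural circuit -/

/-- Under small constants, every gate of the natural circuit holds a representative of the integer
value. [cite: KnuthTAOCP2, §4.1] -/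
theorem rep (hc : ∀ g, (Z.cval g).natAbs < 2 ^ (Z.W g - 1)) (g : List Bool) :
    ((Z.toNat.val g : ℕ) : ℤ) ≡ Z.valZ g [ZMOD 2 ^ Z.W g] :=
  Z.val_toNat_modEq hc _ g le_rfl

/-- **Sign read-out**: if `|valZ g| < 2^{W g − 1}` then `valZ g < 0` iff bit `W g − 1` of the natural
gate `g` is set — one `bitLang` query (`SuccCircuit.mem_bitLang_iff`). [cite: KnuthTAOCP2, §4.1] [cite: KoiranPerifel2009VPSPACE, §3.1, Def. 1 (the sign query)] -/
theorem valZ_neg_iff (hc : ∀ g, (Z.cval g).natAbs < 2 ^ (Z.W g - 1)) {g : List Bool}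
    (hb : (Z.valZ g).natAbs < 2 ^ (Z.W g - 1)) : Z.valZ g < 0 ↔ (Z.toNat.val g).testBit (Z.W g - 1) = true := by
  obtain ⟨v, hv⟩ : ∃ v, Z.W g = v + 1 := ⟨Z.W g - 1, by have := Z.W_pos g; omega⟩
  have h := Z.rep hc g
  rw [hv] at h hb ⊢
  simp only [Nat.add_sub_cancel] at hb ⊢
  exact SuccCircuit.neg_iff_testBit hb h

/-- **Zero test**: if `|valZ g| < 2^{W g − 1}` then `valZ g = 0` iff the natural gate's value is
`≡ 0 (mod 2^{W g})` — what a select gate of width `W g` tests against a zero constant. [cite: KnuthTAOCP2, §4.1] -/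
theorem valZ_eq_zero_iff (hc : ∀ g, (Z.cval g).natAbs < 2 ^ (Z.W g - 1)) {g : List Bool}
    (hb : (Z.valZ g).natAbs < 2 ^ (Z.W g - 1)) : Z.valZ g = 0 ↔ Z.toNat.val g % 2 ^ Z.W g = 0 := by
  obtain ⟨v, hv⟩ : ∃ v, Z.W g = v + 1 := ⟨Z.W g - 1, by have := Z.W_pos g; omega⟩
  have h := Z.rep hc g
  rw [hv] at h hb ⊢
  simp only [Nat.add_sub_cancel] at hb
  exact SuccCircuit.eq_zero_iff_mod hb h

/-- **Magnitude read-out** (nonnegative case): if `0 ≤ valZ g` and `|valZ g| < 2^{W g − 1}` then the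
bits of `|valZ g|` below `W g` are those of the natural gate `g` (and the higher ones vanish,
`SuccCircuit.testBit_natAbs_eq_false`); for `valZ g < 0` use a gate denoting `−valZ g`. [cite: KnuthTAOCP2, §4.1] [cite: KoiranPerifel2009VPSPACE, §3.1, Def. 1 (the bit queries)] -/
theorem testBit_natAbs_valZ (hc : ∀ g, (Z.cval g).natAbs < 2 ^ (Z.W g - 1)) {g : List Bool}
    (h0 : 0 ≤ Z.valZ g) (hb : (Z.valZ g).natAbs < 2 ^ (Z.W g - 1)) {j : ℕ} (hj : j < Z.W g) :
    (Z.valZ g).natAbs.testBit j = (Z.toNat.val g).testBit j := by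
  obtain ⟨v, hv⟩ : ∃ v, Z.W g = v + 1 := ⟨Z.W g - 1, by have := Z.W_pos g; omega⟩
  have h := Z.rep hc g
  rw [hv] at h hb hj
  simp only [Nat.add_sub_cancel] at hb
  exact SuccCircuit.testBit_natAbs_of_nonneg h0 hb h (by omega)

/-! ### The sign–magnitude language of an integer circuit -/

/-- **The sign–magnitude read-out of an integer circuit is in `PSPACE`.** For an integer circuit
with small constants, polynomial-time decoders `pos w` (a gate holding `x_w`), `neg w` (a gate of
the same width holding `−x_w`), `idx w`, `knd w`, and the height bound `|x_w| < 2^{W(pos w) − 1}` for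
every `w`: `{w | (knd w = 1 ∧ x_w < 0) ∨ (knd w = 0 ∧ bit (idx w) of |x_w| is set)} ∈ PSPACE`.
(Junk strings may be decoded to any fixed pair of gates satisfying the two algebraic hypotheses,
e.g. a zero constant twice.) [cite: KoiranPerifel2009VPSPACE, §3.1, Def. 1 and §3.2, Prop. 1] [cite: KnuthTAOCP2, §4.1] -/
theorem signMag_mem_PSPACE (hc : ∀ g, (Z.cval g).natAbs < 2 ^ (Z.W g - 1))
    {pos neg : List Bool → List Bool} {idx knd : List Bool → ℕ}
    (hpos : CodeFP strE strE pos) (hneg : CodeFP strE strE neg) (hidx : CodeFP strE natE idx)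
    (hknd : CodeFP strE natE knd) (hval : ∀ w, Z.valZ (neg w) = -Z.valZ (pos w))
    (hWn : ∀ w, Z.W (neg w) = Z.W (pos w)) (hb : ∀ w, (Z.valZ (pos w)).natAbs < 2 ^ (Z.W (pos w) - 1)) :
    ({w | (knd w = 1 ∧ Z.valZ (pos w) < 0) ∨
      (knd w = 0 ∧ (Z.valZ (pos w)).natAbs.testBit (idx w) = true)} : Language Bool) ∈ PSPACE := by
  have hv : CodeFP strE natE (fun w => Z.W (pos w) - 1) :=
    natSub.comp ((Z.W_fp.comp hpos).pair (const strE (1 : ℕ)))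
  have hW1 : ∀ w, Z.W (pos w) = (Z.W (pos w) - 1) + 1 := fun w => by have := Z.W_pos (pos w); omega
  refine Z.toNat.signMag_mem_PSPACE_of_rep (x := fun w => Z.valZ (pos w)) hpos hneg hidx hknd hv hb
    (fun w => ?_) (fun w => ?_)
  · rw [← hW1]; exact Z.rep hc (pos w)
  · rw [← hW1, ← hWn w, ← hval w]; exact Z.rep hc (neg w)

end SuccCircuitZ

end Literature.Computability.Complexity
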